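import Literature.AlgebraicGeometry.Frobenioids.PerfectionCoAngularDivisors
import Literature.AlgebraicGeometry.Frobenioids.BiratGerms
import HarnessLib

/-!
# Frobenioids I, Proposition 3.2 (iii) "`C^pf` is a Frobenioid": Definition 1.3 (vi) for the perfection —
# base-equivalent, metrically equivalent co-angular pre-steps differ by a unit (PROOFS)

Mochizuki, *The geometry of Frobenioids I: the general theory*, Kyushu J. Math. **62** (2008)
293–400, Definition 1.3 (vi) p. 25, Proposition 3.2 (iii) p. 59 [cite: MochizukiFrdI2008, Prop. 3.2 (iii) p.59].

PROOF-ONLY piece of the row «`C^pf` is a Frobenioid» (row `FrdI:Prop3.2(iii)-frobenioid`, carve-up v2,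
L1-lead R99 (2): Def. 1.3 (iv)/(vi) for `Perfection.ops hF`, seat abc-iut-w5-d246), for `C` of
Frobenius-isotropic type (`hiso`):

* `vi_perfection`: two co-angular pre-steps `φ, ψ : (A, n) → (B, m)` of `C^pf` with `Base φ = Base ψ` and
  `Div φ = Div ψ` (in `Φ^pf(Base A)`) satisfy `ψ ≫ α = φ` for some `α ∈ O^×((B, m))`.  Printed argument made
  explicit: representatives `ρ₁, ρ₂ : A^{(E)} → B^{(B₀)}` at a common level have the same `Base`; the
  equality of perfected divisors `z₁^{1/(nE)} = z₂^{1/(nE)}` unwinds to `z₁^T = z₂^T` for some `T`, and after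
  transport by the factor `T·deg(A → A′)` (to an isotropic domain, Def. 1.3 (vii)(b)) the two transports have
  EQUAL zero divisors (Prop. 1.10 (i), `pull_frob_div_lift`) and are co-angular pre-steps of `C`, so
  Def. 1.3 (vi) of `C` gives a unit `α₀ ∈ O^×(B^{(c)})` with `ρ₂′ ≫ α₀ = ρ₁′`; its class (abc-iut-L1-d9's
  `endClass`) is the required unit of `(B, m)`.
No new definitions; nothing here is specific to the abc programme.
-/

namespace Literature.AlgebraicGeometry.Frobenioids

namespace PreFrobenioid

namespace Perfection

open CategoryTheory Opposite

universe w v v' u u'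

variable {D : Type u} [Category.{v} D] {Φ : Dᵒᵖ ⥤ CommMonCat.{w}}
  {C : Type u'} [Category.{v'} C] {F : C ⥤ ElemFrobenioid Φ} {hF : IsFrobenioid F}

/-! ### Units of `C^pf` from units of `C` -/

/-- The class of a unit `α₀ ∈ O^×(B^{(c)})` is a unit of `(B, m)` in `C^pf`: an automorphism of `(B, m)` with
base-identity linear `hom`. [cite: MochizukiFrdI2008, Def. 3.1 (iii) p.57] -/
theorem exists_unit_of_unit (Y : Perfection hF) (c : ℕ+) (α₀ : Aut (frobPow hF Y.obj c))
    (hα₀ : α₀ ∈ unitsSubgroup F (frobPow hF Y.obj c)) :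
    ∃ α ∈ (ops hF).unitsSubgroup Y, α.hom = endClass Y c α₀.hom := by
  refine ⟨⟨endClass Y c α₀.hom, endClass Y c α₀.inv, ?_, ?_⟩, ⟨?_, ?_⟩, rfl⟩
  · rw [endClass_comp, α₀.hom_inv_id, endClass_id]
  · rw [endClass_comp, α₀.inv_hom_id, endClass_id]
  · exact (isBaseIdentity_endClass_iff Y c α₀.hom).mpr hα₀.1
  · exact (isLinear_endClass_iff Y c α₀.hom).mpr hα₀.2

/-! ### Definition 1.3 (vi) -/

/-- **Def. 1.3 (vi) for `C^pf`** (for `C` of Frobenius-isotropic type): base-equivalent, metrically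
equivalent co-angular pre-steps `φ, ψ : X → Y` of `C^pf` differ by a unit of `Y`: `ψ ≫ α = φ` for some
`α ∈ O^×(Y)`. [cite: MochizukiFrdI2008, Prop. 3.2 (iii) p.59] -/
theorem vi_perfection (hiso : IsOfType (IsFrobeniusIsotropic F)) ⦃X Y : Perfection hF⦄ (φ ψ : X ⟶ Y)
    (hφ : (ops hF).IsCoAngularPreStep φ) (hψ : (ops hF).IsCoAngularPreStep ψ)
    (hb : (ops hF).BaseEquivalent φ ψ) (hm : (ops hF).MetricallyEquivalent φ ψ) :
    ∃ α ∈ (ops hF).unitsSubgroup Y, ψ ≫ α.hom = φ := by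
  obtain ⟨⟨⟨a₁, b₁, hab₁⟩, ρ₁⟩, rfl⟩ := Hom.mk_surjective φ
  obtain ⟨⟨⟨a₂, b₂, hab₂⟩, ρ₂⟩, rfl⟩ := Hom.mk_surjective ψ
  change X.idx * a₁ = Y.idx * b₁ at hab₁
  change X.idx * a₂ = Y.idx * b₂ at hab₂
  change (frobPow hF X.obj a₁ ⟶ frobPow hF Y.obj b₁) at ρ₁
  change (frobPow hF X.obj a₂ ⟶ frobPow hF Y.obj b₂) at ρ₂
  have hρ₁ : IsPreStep F ρ₁ := (isPreStep_mk_iff (⟨⟨a₁, b₁, hab₁⟩, ρ₁⟩ : Rep X Y)).mp hφ.2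
  have hρ₂ : IsPreStep F ρ₂ := (isPreStep_mk_iff (⟨⟨a₂, b₂, hab₂⟩, ρ₂⟩ : Rep X Y)).mp hψ.2
  change Rep.baseMap (⟨⟨a₁, b₁, hab₁⟩, ρ₁⟩ : Rep X Y) = Rep.baseMap (⟨⟨a₂, b₂, hab₂⟩, ρ₂⟩ : Rep X Y) at hb
  change Rep.div (⟨⟨a₁, b₁, hab₁⟩, ρ₁⟩ : Rep X Y) = Rep.div (⟨⟨a₂, b₂, hab₂⟩, ρ₂⟩ : Rep X Y) at hm
  obtain ⟨A', φ₀, hφ₀, hA'⟩ := hiso X.obj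
  -- STEP 1: a common level `(E, B₀) = (a₁·a₂, b₁·a₂)`
  have hsw : b₁ * a₂ = a₁ * b₂ := by
    have := Level.b_mul_a (⟨a₁, b₁, hab₁⟩ : Level X Y) ⟨a₂, b₂, hab₂⟩
    exact this
  have hE : X.idx * (a₁ * a₂) = Y.idx * (b₁ * a₂) := by rw [← mul_assoc, hab₁, mul_assoc]
  have h₁E : Level.LE (⟨a₁, b₁, hab₁⟩ : Level X Y) ⟨a₁ * a₂, b₁ * a₂, hE⟩ := ⟨dvd_mul_right _ _, dvd_mul_right _ _⟩
  have h₂E : Level.LE (⟨a₂, b₂, hab₂⟩ : Level X Y) ⟨a₁ * a₂, b₁ * a₂, hE⟩ :=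
    ⟨dvd_mul_left _ _, Dvd.intro_left a₁ hsw.symm⟩
  rw [← baseMap_lift (⟨a₁, b₁, hab₁⟩ : Level X Y) _ h₁E ρ₁, ← baseMap_lift (⟨a₂, b₂, hab₂⟩ : Level X Y) _ h₂E ρ₂] at hb
  rw [← div_lift (⟨a₁, b₁, hab₁⟩ : Level X Y) _ h₁E ρ₁, ← div_lift (⟨a₂, b₂, hab₂⟩ : Level X Y) _ h₂E ρ₂] at hm
  rw [← Hom.mk_lift (⟨⟨a₁, b₁, hab₁⟩, ρ₁⟩ : Rep X Y) ⟨a₁ * a₂, b₁ * a₂, hE⟩ h₁E,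
    ← Hom.mk_lift (⟨⟨a₂, b₂, hab₂⟩, ρ₂⟩ : Rep X Y) ⟨a₁ * a₂, b₁ * a₂, hE⟩ h₂E]
  have hR₁ : IsPreStep F (Level.lift (⟨a₁, b₁, hab₁⟩ : Level X Y) ⟨a₁ * a₂, b₁ * a₂, hE⟩ h₁E ρ₁) :=
    (isPreStep_lift_iff (⟨⟨a₁, b₁, hab₁⟩, ρ₁⟩ : Rep X Y) _ h₁E).mpr hρ₁
  have hR₂ : IsPreStep F (Level.lift (⟨a₂, b₂, hab₂⟩ : Level X Y) ⟨a₁ * a₂, b₁ * a₂, hE⟩ h₂E ρ₂) :=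
    (isPreStep_lift_iff (⟨⟨a₂, b₂, hab₂⟩, ρ₂⟩ : Rep X Y) _ h₂E).mpr hρ₂
  generalize a₁ * a₂ = E at hE h₁E h₂E hR₁ hR₂ hb hm ⊢
  generalize b₁ * a₂ = B₀ at hE h₁E h₂E hR₁ hR₂ hb hm ⊢
  generalize Level.lift (⟨a₁, b₁, hab₁⟩ : Level X Y) ⟨E, B₀, hE⟩ h₁E ρ₁ = R₁ at hR₁ hb hm ⊢
  generalize Level.lift (⟨a₂, b₂, hab₂⟩ : Level X Y) ⟨E, B₀, hE⟩ h₂E ρ₂ = R₂ at hR₂ hb hm ⊢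
  -- STEP 2: unwind the equality of perfected divisors to `z₁^T = z₂^T`
  change Frobenioids.Perfection.mk (pull Φ (Base F (frob hF X.obj E)) (Div F R₁)) (X.idx * E) =
    Frobenioids.Perfection.mk (pull Φ (Base F (frob hF X.obj E)) (Div F R₂)) (X.idx * E) at hm
  obtain ⟨N, hN⟩ := Frobenioids.Perfection.mk_eq_mk_iff.mp hm
  -- STEP 3: go up by `T = N·(n·E)·deg φ₀`: equal zero divisors, isotropic domain
  have hdT : PreFrobenioid.degFr F φ₀ ∣ E * (N * (X.idx * E) * PreFrobenioid.degFr F φ₀) :=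
    (dvd_mul_left _ _).mul_left _
  have hET : X.idx * (E * (N * (X.idx * E) * PreFrobenioid.degFr F φ₀)) =
      Y.idx * (B₀ * (N * (X.idx * E) * PreFrobenioid.degFr F φ₀)) := by rw [← mul_assoc, hE, mul_assoc]
  have hT : Level.LE (⟨E, B₀, hE⟩ : Level X Y) ⟨_, _, hET⟩ := ⟨dvd_mul_right _ _, dvd_mul_right _ _⟩
  have hdiv₁ := pull_frob_div_lift (⟨⟨E, B₀, hE⟩, R₁⟩ : Rep X Y) ⟨_, _, hET⟩ hT
  have hdiv₂ := pull_frob_div_lift (⟨⟨E, B₀, hE⟩, R₂⟩ : Rep X Y) ⟨_, _, hET⟩ hT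
  rw [degFr_frobTrans_mul] at hdiv₁ hdiv₂
  change pull Φ (Base F (frob hF X.obj (E * (N * (X.idx * E) * PreFrobenioid.degFr F φ₀))))
      (Div F (Level.lift _ _ hT R₁)) = pull Φ (Base F (frob hF X.obj E)) (Div F R₁) ^ _ at hdiv₁
  change pull Φ (Base F (frob hF X.obj (E * (N * (X.idx * E) * PreFrobenioid.degFr F φ₀))))
      (Div F (Level.lift _ _ hT R₂)) = pull Φ (Base F (frob hF X.obj E)) (Div F R₂) ^ _ at hdiv₂
  have hdiveq : Div F (Level.lift (⟨E, B₀, hE⟩ : Level X Y) ⟨_, _, hET⟩ hT R₁) =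
      Div F (Level.lift (⟨E, B₀, hE⟩ : Level X Y) ⟨_, _, hET⟩ hT R₂) := by
    haveI := isIso_base_frob hF X.obj (E * (N * (X.idx * E) * PreFrobenioid.degFr F φ₀))
    apply pull_injective (Base F (frob hF X.obj (E * (N * (X.idx * E) * PreFrobenioid.degFr F φ₀))))
    rw [hdiv₁, hdiv₂, PNat.mul_coe, pow_mul, pow_mul, PNat.mul_coe, hN]
  have hbase : Base F (Level.lift (⟨E, B₀, hE⟩ : Level X Y) ⟨_, _, hET⟩ hT R₁) =
      Base F (Level.lift (⟨E, B₀, hE⟩ : Level X Y) ⟨_, _, hET⟩ hT R₂) := by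
    rw [base_hom_eq (⟨_, Level.lift (⟨E, B₀, hE⟩ : Level X Y) ⟨_, _, hET⟩ hT R₁⟩ : Rep X Y),
      base_hom_eq (⟨_, Level.lift (⟨E, B₀, hE⟩ : Level X Y) ⟨_, _, hET⟩ hT R₂⟩ : Rep X Y)]
    change baseInvFrob hF X.obj _ ≫ Rep.baseMap ⟨_, Level.lift (⟨E, B₀, hE⟩ : Level X Y) ⟨_, _, hET⟩ hT R₁⟩ ≫ _ =
      baseInvFrob hF X.obj _ ≫ Rep.baseMap ⟨_, Level.lift (⟨E, B₀, hE⟩ : Level X Y) ⟨_, _, hET⟩ hT R₂⟩ ≫ _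
    rw [baseMap_lift, baseMap_lift]
    exact congrArg (fun k => baseInvFrob hF X.obj _ ≫ k ≫ Base F (frob hF Y.obj _)) hb
  have hS₁ : IsCoAngularPreStep F (Level.lift (⟨E, B₀, hE⟩ : Level X Y) ⟨_, _, hET⟩ hT R₁) :=
    isCoAngularPreStep_of_isPreStep_frobPow hφ₀ hA' hdT ((isPreStep_lift_iff (⟨⟨E, B₀, hE⟩, R₁⟩ : Rep X Y) _ hT).mpr hR₁)
  have hS₂ : IsCoAngularPreStep F (Level.lift (⟨E, B₀, hE⟩ : Level X Y) ⟨_, _, hET⟩ hT R₂) :=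
    isCoAngularPreStep_of_isPreStep_frobPow hφ₀ hA' hdT ((isPreStep_lift_iff (⟨⟨E, B₀, hE⟩, R₂⟩ : Rep X Y) _ hT).mpr hR₂)
  -- STEP 4: Def. 1.3 (vi) of `C`, and the class of the unit
  obtain ⟨α₀, hα₀, hrel⟩ := hF.vi _ _ hS₁ hS₂ hbase hdiveq
  obtain ⟨α, hα, hαhom⟩ := exists_unit_of_unit Y _ α₀ hα₀
  refine ⟨α, hα, ?_⟩
  rw [← Hom.mk_lift (⟨⟨E, B₀, hE⟩, R₁⟩ : Rep X Y) ⟨_, _, hET⟩ hT,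
    ← Hom.mk_lift (⟨⟨E, B₀, hE⟩, R₂⟩ : Rep X Y) ⟨_, _, hET⟩ hT, hαhom]
  rw [mk_comp_endClass, hrel]

end Perfection

end PreFrobenioid

end Literature.AlgebraicGeometry.Frobenioids
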